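import Literature.Analysis.FluidPDE.DivFreeSobolevTesting
import Literature.Analysis.FunctionSpaces.WeakDerivInner
import HarnessLib

/-!
# The local skew-symmetry identity of the trilinear form against a divergence-free field

Analysis/FluidPDE theorem file (no new definitions, everything PROVED), on the inline proof path
of the named fact `Literature.Analysis.FluidPDE.local_leray_weak_strong_uniqueness`
(Lemarié-Rieusset 2016, Thm. 14.7): the identity behind the rearrangement of the nonlinear terms
of the balances of `|u₁|²`, `|u₂|²`, `u₁·u₂` on a time slice (file p. 515, "`∂ₜ(u₁·u₂) = … -
u₁·((u₂·∇)u₂) - u₂·((u₁·∇)u₁) …`", p. 516 "`… + ∫∫ (u₁·∇φ)|w|²/2 - ∫∫ φ u₁·(w·∇w)`"), in its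
local form for fields that are only locally in `H¹ ∩ L⁶` (slices of local Leray solutions):

* `integral_fderiv_apply_mul_inner_add_eq_zero` — for `b` weakly divergence free with
  `b ∈ L³(B(x₀, ρ + 2))`, `c, d ∈ W^{1,2}(B(x₀, ρ)) ∩ L⁶(B(x₀, ρ))` with weak derivatives
  `Gc, Gd`, and `φ ∈ C_c^∞(B(x₀, ρ))`,
  `∫ (b·∇φ) ⟨c, d⟩ + ∫ φ (⟨d, (b·∇)c⟩ + ⟨c, (b·∇)d⟩) = 0`
  ("`b(b; c, φd) + b(b; d, φc) = -∫ ⟨c,d⟩ b·∇φ`"; Serrin 1963, §4; Robinson–Rodrigo–Sadowski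
  2016, Exercise 6.4 / Lemma 8.18, there on the whole space or the torus).

Proof: `W = φ⟨c, d⟩` has the weak derivative `DW = Dφ ⟨c,d⟩ + φ(⟨d, Dc⟩ + ⟨c, Dd⟩)` on the
ball (`HasWeakFDerivOn.inner`, `HasWeakFDerivOn.smul_contDiff`, `WeakDerivInner.lean`), hence on
the whole space (`HasWeakFDerivOn.top_of_eq_zero_off`, both vanish off `tsupport φ`), with
`DW ∈ L^{3/2}` by Hölder (`L⁶·L⁶`, `L⁶·L²`); and a weakly divergence-free `b ∈ L³` annihilates
such gradients (`IsWeaklyDivFree.integral_weakDeriv_apply_eq_zero`, `DivFreeSobolevTesting.lean`).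

## References

* J. Serrin, in *Nonlinear Problems* (1963), §4. [`Serrin1963`]
* J. C. Robinson, J. L. Rodrigo, W. Sadowski, *The Three-Dimensional Navier–Stokes Equations*
  (2016), Exercise 6.4, Lemma 8.18. [`RobinsonRodrigoSadowski2016`]
* P. G. Lemarié-Rieusset, *The Navier–Stokes Problem in the 21st Century* (2016), Thm. 14.7,
  proof, file pp. 515–516. [`LemarieRieusset2016`]
-/

noncomputable section

open MeasureTheory TopologicalSpace Set Function Filter Topology InnerProductSpace Metric
open scoped RealInnerProductSpace ENNReal NNReal ContDiff

namespace Literature.Analysis.FluidPDE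

-- nested operator types (`smulRight`, `innerSL … ∘L …`)
set_option maxSynthPendingDepth 3

/-! ## Hölder triples -/

/-- `1/2 + 1/6 = 1/(3/2)`. [folklore] -/
private theorem holderTriple_two_six_threeHalves' : ENNReal.HolderTriple 2 6 (3 / 2) := by
  refine ⟨?_⟩
  rw [ENNReal.inv_div (Or.inr (by norm_num)) (Or.inr (by norm_num))]
  have e2 : (2 : ℝ≥0∞)⁻¹ = ((2⁻¹ : ℝ≥0) : ℝ≥0∞) := by rw [ENNReal.coe_inv (by norm_num)]; norm_num
  have e6 : (6 : ℝ≥0∞)⁻¹ = ((6⁻¹ : ℝ≥0) : ℝ≥0∞) := by rw [ENNReal.coe_inv (by norm_num)]; norm_num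
  have e23 : (2 / 3 : ℝ≥0∞) = ((2 / 3 : ℝ≥0) : ℝ≥0∞) := by rw [ENNReal.coe_div (by norm_num)]; norm_num
  rw [e2, e6, e23, ← ENNReal.coe_add, ENNReal.coe_inj]
  norm_num

/-- `1/6 + 1/6 = 1/3` (a private copy of the tree's `holderTriple_six_six_three`, `KatoBilinearEstimates.lean`, kept private to keep the import closure small). [folklore] -/
private theorem holderTriple_six_six_three' : ENNReal.HolderTriple 6 6 3 := by
  refine ⟨?_⟩
  have e6 : (6 : ℝ≥0∞)⁻¹ = ((6⁻¹ : ℝ≥0) : ℝ≥0∞) := by rw [ENNReal.coe_inv (by norm_num)]; norm_num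
  have e3 : (3 : ℝ≥0∞)⁻¹ = ((3⁻¹ : ℝ≥0) : ℝ≥0∞) := by rw [ENNReal.coe_inv (by norm_num)]; norm_num
  rw [e6, e3, ← ENNReal.coe_add, ENNReal.coe_inj]
  norm_num

/-! ## The identity -/

section Main

variable {b c d : EuclideanSpace ℝ (Fin 3) → EuclideanSpace ℝ (Fin 3)}
  {Gc Gd : EuclideanSpace ℝ (Fin 3) → EuclideanSpace ℝ (Fin 3) →L[ℝ] EuclideanSpace ℝ (Fin 3)}
  {x₀ : EuclideanSpace ℝ (Fin 3)} {ρ : ℝ} {φ : EuclideanSpace ℝ (Fin 3) → ℝ}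

/-- **Local skew-symmetry of the trilinear form** (Serrin 1963, §4; Robinson–Rodrigo–Sadowski
2016, Exercise 6.4; the rearrangement step of Lemarié-Rieusset 2016, Thm. 14.7, pp. 515–516).
Let `b` be weakly divergence free and measurable with `b ∈ L³(B(x₀, ρ + 2))`, let `c, d` have
weak derivatives `Gc, Gd` on `B(x₀, ρ)` with `c, d ∈ L⁶(B(x₀, ρ))`, `Gc, Gd ∈ L²(B(x₀, ρ))`, and
let `φ ∈ C_c^∞(B(x₀, ρ))`. Then
`∫ Dφ(b) ⟨c, d⟩ + ∫ φ (⟨d, Gc b⟩ + ⟨c, Gd b⟩) = 0`.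
[cite: Serrin1963, §4; LemarieRieusset2016, Thm. 14.7, proof (file pp. 515–516)] -/
theorem integral_fderiv_apply_mul_inner_add_eq_zero (hdiv : IsWeaklyDivFree b)
    (hbm : AEStronglyMeasurable b volume) (hb3 : eLpNorm ((ball x₀ (ρ + 2)).indicator b) 3 volume < ⊤)
    (hc : FunctionSpaces.HasWeakFDerivOn ⟨ball x₀ ρ, isOpen_ball⟩ volume c Gc)
    (hd : FunctionSpaces.HasWeakFDerivOn ⟨ball x₀ ρ, isOpen_ball⟩ volume d Gd)
    (hc6 : MemLp c 6 (volume.restrict (ball x₀ ρ))) (hd6 : MemLp d 6 (volume.restrict (ball x₀ ρ)))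
    (hGc2 : MemLp Gc 2 (volume.restrict (ball x₀ ρ))) (hGd2 : MemLp Gd 2 (volume.restrict (ball x₀ ρ)))
    (hφ : FunctionSpaces.IsTestFunctionOn (⟨ball x₀ ρ, isOpen_ball⟩ : Opens (EuclideanSpace ℝ (Fin 3))) φ) :
    (∫ x, fderiv ℝ φ x (b x) * ⟪c x, d x⟫) +
      ∫ x, φ x * (⟪d x, Gc x (b x)⟫ + ⟪c x, Gd x (b x)⟫) = 0 := by
  haveI := holderTriple_two_six_threeHalves'
  haveI := holderTriple_six_six_three'
  set B : Set (EuclideanSpace ℝ (Fin 3)) := ball x₀ ρ with hB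
  set U : Opens (EuclideanSpace ℝ (Fin 3)) := ⟨ball x₀ ρ, isOpen_ball⟩ with hU
  have hUB : (U : Set (EuclideanSpace ℝ (Fin 3))) = B := rfl
  haveI hfin : IsFiniteMeasure ((volume : Measure (EuclideanSpace ℝ (Fin 3))).restrict B) :=
    isFiniteMeasure_restrict.2 measure_ball_lt_top.ne
  have h26 : (2 : ℝ≥0∞) ≤ 6 := by norm_num
  have hc2 : MemLp c 2 (volume.restrict B) := hc6.mono_exponent h26
  have hd2 : MemLp d 2 (volume.restrict B) := hd6.mono_exponent h26
  have hGc2v : ∀ v, MemLp (fun x => Gc x v) 2 (volume.restrict B) := fun v =>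
    (ContinuousLinearMap.apply ℝ (EuclideanSpace ℝ (Fin 3)) v).comp_memLp' hGc2
  have hGd2v : ∀ v, MemLp (fun x => Gd x v) 2 (volume.restrict B) := fun v =>
    (ContinuousLinearMap.apply ℝ (EuclideanSpace ℝ (Fin 3)) v).comp_memLp' hGd2
  -- ## the weak derivative of `W = φ ⟨c, d⟩` on the ball
  have hI : FunctionSpaces.HasWeakFDerivOn U volume (fun x => ⟪c x, d x⟫)
      fun x => (innerSL ℝ (d x)).comp (Gc x) + (innerSL ℝ (c x)).comp (Gd x) :=
    FunctionSpaces.HasWeakFDerivOn.inner hc2 hd2 hc hd hGc2v hGd2v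
  set W : EuclideanSpace ℝ (Fin 3) → ℝ := fun x => φ x • ⟪c x, d x⟫ with hW
  set GW : EuclideanSpace ℝ (Fin 3) → EuclideanSpace ℝ (Fin 3) →L[ℝ] ℝ := fun x =>
    (fderiv ℝ φ x).smulRight ⟪c x, d x⟫ + φ x • ((innerSL ℝ (d x)).comp (Gc x) + (innerSL ℝ (c x)).comp (Gd x)) with hGW
  have hWU : FunctionSpaces.HasWeakFDerivOn U volume W GW := hI.smul_contDiff hφ.contDiff
  -- ## zero extension
  have hK : IsCompact (tsupport φ) := hφ.hasCompactSupport
  have hφ0 : ∀ x, x ∉ tsupport φ → φ x = 0 := fun x hx => image_eq_zero_of_notMem_tsupport hx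
  have hDφ0 : ∀ x, x ∉ tsupport φ → fderiv ℝ φ x = 0 := fun x hx =>
    notMem_support.1 fun h => hx (support_fderiv_subset ℝ h)
  have hW0 : ∀ x, x ∉ tsupport φ → W x = 0 := fun x hx => by
    simp only [hW, hφ0 x hx, zero_smul]
  have hGW0 : ∀ x, x ∉ tsupport φ → GW x = 0 := fun x hx => by
    simp only [hGW, hφ0 x hx, hDφ0 x hx, zero_smul, add_zero, ContinuousLinearMap.zero_smulRight]
  have hWtop : FunctionSpaces.HasWeakFDerivOn (⊤ : Opens (EuclideanSpace ℝ (Fin 3))) volume W GW :=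
    hWU.top_of_eq_zero_off hK hφ.tsupport_subset hW0 hGW0
  have hWρ : tsupport W ⊆ ball x₀ ρ := (tsupport_smul_subset_left (f := φ) (g := fun x => ⟪c x, d x⟫)).trans hφ.tsupport_subset
  have hGWρ : ∀ x, x ∉ ball x₀ ρ → GW x = 0 := fun x hx => hGW0 x fun h => hx (hφ.tsupport_subset h)
  -- ## `GW ∈ L^{3/2}`
  obtain ⟨Cφ, hCφ⟩ := hφ.contDiff.continuous.bounded_above_of_compact_support hφ.hasCompactSupport
  have hDφc : Continuous (fderiv ℝ φ) := hφ.contDiff.continuous_fderiv (by simp)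
  obtain ⟨Cφ', hCφ'⟩ := hDφc.bounded_above_of_compact_support (hφ.hasCompactSupport.fderiv (𝕜 := ℝ))
  -- the two pieces `A₁ = Dφ ⊗ ⟨c,d⟩`, `A₂ = φ (⟨d, Dc⟩ + ⟨c, Dd⟩)`
  set A₁ : EuclideanSpace ℝ (Fin 3) → EuclideanSpace ℝ (Fin 3) →L[ℝ] ℝ := fun x =>
    (fderiv ℝ φ x).smulRight ⟪c x, d x⟫ with hA₁
  set A₂ : EuclideanSpace ℝ (Fin 3) → EuclideanSpace ℝ (Fin 3) →L[ℝ] ℝ := fun x =>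
    φ x • ((innerSL ℝ (d x)).comp (Gc x) + (innerSL ℝ (c x)).comp (Gd x)) with hA₂
  have hGWA : GW = A₁ + A₂ := rfl
  -- measurability
  have hcm : AEStronglyMeasurable c (volume.restrict B) := hc6.1
  have hdm : AEStronglyMeasurable d (volume.restrict B) := hd6.1
  have hcdm : AEStronglyMeasurable (fun x => ⟪c x, d x⟫) (volume.restrict B) := hcm.inner hdm
  have hA₁m : AEStronglyMeasurable A₁ (volume.restrict B) :=
    (ContinuousLinearMap.smulRightL ℝ (EuclideanSpace ℝ (Fin 3)) ℝ).continuous₂.comp_aestronglyMeasurable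
      (hDφc.aestronglyMeasurable.prodMk hcdm)
  have hcompm : ∀ {e : EuclideanSpace ℝ (Fin 3) → EuclideanSpace ℝ (Fin 3)}
      {G : EuclideanSpace ℝ (Fin 3) → EuclideanSpace ℝ (Fin 3) →L[ℝ] EuclideanSpace ℝ (Fin 3)},
      AEStronglyMeasurable e (volume.restrict B) → AEStronglyMeasurable G (volume.restrict B) →
      AEStronglyMeasurable (fun x => (innerSL ℝ (e x)).comp (G x)) (volume.restrict B) := by
    intro e G he hG
    have h1 : AEStronglyMeasurable (fun x => innerSL ℝ (e x)) (volume.restrict B) :=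
      (innerSL ℝ).continuous.comp_aestronglyMeasurable he
    exact (ContinuousLinearMap.compL ℝ (EuclideanSpace ℝ (Fin 3)) (EuclideanSpace ℝ (Fin 3)) ℝ).continuous₂.comp_aestronglyMeasurable
      (h1.prodMk hG)
  have hA₂m : AEStronglyMeasurable A₂ (volume.restrict B) :=
    (hφ.contDiff.continuous.aestronglyMeasurable).smul ((hcompm hdm hGc2.1).add (hcompm hcm hGd2.1))
  -- `L^{3/2}` bounds on the ball
  have h32le3 : (3 / 2 : ℝ≥0∞) ≤ 3 := by
    rw [ENNReal.div_le_iff (by norm_num) (by norm_num)]; norm_num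
  have hcd3 : MemLp (fun x => ‖c x‖ * ‖d x‖) 3 (volume.restrict B) := hd6.norm.mul' hc6.norm
  have hcd32 : MemLp (fun x => ‖c x‖ * ‖d x‖) (3 / 2) (volume.restrict B) := hcd3.mono_exponent h32le3
  have hdGc : MemLp (fun x => ‖d x‖ * ‖Gc x‖) (3 / 2) (volume.restrict B) := hGc2.norm.mul hd6.norm
  have hcGd : MemLp (fun x => ‖c x‖ * ‖Gd x‖) (3 / 2) (volume.restrict B) := hGd2.norm.mul hc6.norm
  have hA₁p : MemLp A₁ (3 / 2) (volume.restrict B) := by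
    refine (hcd32.const_mul Cφ').of_le_mul (c := 1) hA₁m (Eventually.of_forall fun x => ?_)
    rw [one_mul, hA₁, ContinuousLinearMap.norm_smulRight_apply]
    simp only [Real.norm_eq_abs]
    calc ‖fderiv ℝ φ x‖ * |⟪c x, d x⟫| ≤ Cφ' * (‖c x‖ * ‖d x‖) := by
          have h1 : |⟪c x, d x⟫| ≤ ‖c x‖ * ‖d x‖ := abs_real_inner_le_norm _ _
          have h2 : ‖fderiv ℝ φ x‖ ≤ Cφ' := hCφ' x
          calc ‖fderiv ℝ φ x‖ * |⟪c x, d x⟫| ≤ ‖fderiv ℝ φ x‖ * (‖c x‖ * ‖d x‖) := by gcongr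
            _ ≤ Cφ' * (‖c x‖ * ‖d x‖) := by gcongr
      _ ≤ |Cφ' * (‖c x‖ * ‖d x‖)| := le_abs_self _
  have hA₂p : MemLp A₂ (3 / 2) (volume.restrict B) := by
    refine ((hdGc.add hcGd).const_mul Cφ).of_le_mul (c := 1) hA₂m (Eventually.of_forall fun x => ?_)
    have hin : ∀ (e : EuclideanSpace ℝ (Fin 3)) (G : EuclideanSpace ℝ (Fin 3) →L[ℝ] EuclideanSpace ℝ (Fin 3)),
        ‖(innerSL ℝ e).comp G‖ ≤ ‖e‖ * ‖G‖ := fun e G =>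
      (ContinuousLinearMap.opNorm_comp_le _ _).trans (by rw [innerSL_apply_norm])
    rw [one_mul, hA₂]
    simp only [Real.norm_eq_abs, Pi.add_apply]
    calc ‖φ x • ((innerSL ℝ (d x)).comp (Gc x) + (innerSL ℝ (c x)).comp (Gd x))‖
        ≤ ‖φ x‖ * (‖(innerSL ℝ (d x)).comp (Gc x)‖ + ‖(innerSL ℝ (c x)).comp (Gd x)‖) := by
          rw [norm_smul]; gcongr; exact norm_add_le _ _
      _ ≤ ‖φ x‖ * (‖d x‖ * ‖Gc x‖ + ‖c x‖ * ‖Gd x‖) := by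
          gcongr
          · exact hin _ _
          · exact hin _ _
      _ ≤ Cφ * (‖d x‖ * ‖Gc x‖ + ‖c x‖ * ‖Gd x‖) := by
          gcongr; exact hCφ x
      _ ≤ |Cφ * (‖d x‖ * ‖Gc x‖ + ‖c x‖ * ‖Gd x‖)| := le_abs_self _
  -- on the whole space (the pieces vanish off the ball)
  have hA₁0 : ∀ x, x ∉ B → A₁ x = 0 := fun x hx => by
    simp only [hA₁, hDφ0 x (fun h => hx (hφ.tsupport_subset h)), ContinuousLinearMap.zero_smulRight]
  have hA₂0 : ∀ x, x ∉ B → A₂ x = 0 := fun x hx => by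
    simp only [hA₂, hφ0 x (fun h => hx (hφ.tsupport_subset h)), zero_smul]
  have hext : ∀ {A : EuclideanSpace ℝ (Fin 3) → EuclideanSpace ℝ (Fin 3) →L[ℝ] ℝ},
      MemLp A (3 / 2) (volume.restrict B) → (∀ x, x ∉ B → A x = 0) → MemLp A (3 / 2) volume := by
    intro A hA hA0
    have h := (memLp_indicator_iff_restrict (μ := (volume : Measure (EuclideanSpace ℝ (Fin 3))))
      (p := (3 / 2 : ℝ≥0∞)) (f := A) measurableSet_ball).2 hA
    have e : B.indicator A = A := funext fun x => by
      by_cases hx : x ∈ B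
      · rw [indicator_of_mem hx]
      · rw [indicator_of_notMem hx, hA0 x hx]
    rwa [e] at h
  have hA₁P : MemLp A₁ (3 / 2) volume := hext hA₁p hA₁0
  have hA₂P : MemLp A₂ (3 / 2) volume := hext hA₂p hA₂0
  have hGWP : MemLp GW (3 / 2) volume := by rw [hGWA]; exact hA₁P.add hA₂P
  -- ## the divergence-free field annihilates `GW`
  have hmain := hdiv.integral_weakDeriv_apply_eq_zero hbm hb3 hWtop hGWP hWρ hGWρ
  -- ## split `GW(b) = A₁(b) + A₂(b)` and identify the two pairings
  have hS2 : ball x₀ ρ ⊆ ball x₀ (ρ + 2) := ball_subset_ball (by linarith)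
  have hInt : ∀ {A : EuclideanSpace ℝ (Fin 3) → EuclideanSpace ℝ (Fin 3) →L[ℝ] ℝ}, MemLp A (3 / 2) volume →
      (∀ x, x ∉ B → A x = 0) → Integrable (fun x => A x (b x)) volume := by
    intro A hA hA0
    have hA0' : ∀ x, x ∉ ball x₀ (ρ + 2) → A x = 0 := fun x hx => hA0 x fun h => hx (hS2 h)
    refine ⟨(isBoundedBilinearMap_apply (𝕜 := ℝ) (E := EuclideanSpace ℝ (Fin 3)) (F := ℝ)).continuous.comp_aestronglyMeasurable
      (hA.1.prodMk hbm), ?_⟩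
    exact lt_of_le_of_lt (lintegral_enorm_apply_le_of_eq_zero_off hA.1 hbm measurableSet_ball hA0')
      (ENNReal.mul_lt_top hA.eLpNorm_lt_top hb3)
  have hI₁ := hInt hA₁P hA₁0
  have hI₂ := hInt hA₂P hA₂0
  have hsplit : ∫ x, GW x (b x) = (∫ x, A₁ x (b x)) + ∫ x, A₂ x (b x) := by
    rw [← integral_add hI₁ hI₂]
    rfl
  have e₁ : (fun x => A₁ x (b x)) = fun x => fderiv ℝ φ x (b x) * ⟪c x, d x⟫ := by
    funext x
    simp only [hA₁, ContinuousLinearMap.smulRight_apply, smul_eq_mul]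
  have e₂ : (fun x => A₂ x (b x)) = fun x => φ x * (⟪d x, Gc x (b x)⟫ + ⟪c x, Gd x (b x)⟫) := by
    funext x
    simp only [hA₂, smul_apply, add_apply, ContinuousLinearMap.coe_comp, comp_apply, innerSL_apply_apply, smul_eq_mul]
  rw [hsplit, e₁, e₂] at hmain
  exact hmain

end Main

end Literature.Analysis.FluidPDE
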